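import Summits.QuantumFields.YangMills.Theorems.BalabanUVNodesN15TwoSpacingGluingCutRowsDefect
import Summits.QuantumFields.YangMills.Theorems.BalabanUVNodesN15TwoSpacingGluingDirichlet
import HarnessLib

/-!
# Route «BalabanUVNodes» (cluster K4 «SpineRates»), Track-A DAG node N15 = NE2, BACKGROUND LAYER — ENTRY 3 AT THE SMOOTH CUT: the flat row `D₃∘(M_χ̃N_□)` for `D₃ = Σ_μ∇*_μ∇_μ + W`
# (the left factor file 40 displays), from the cube's per-cube locality WITH DEFECT `M_χΔ_aN_□ = M_χ + E`, `Δ_a = D₃ + N_L`, FILE 63's cut rows, a cut row of `N_L∘N_□`, and the bump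

Cell `pub-ymgap`, seat `pub-ymgap-dag-n15-w3` (WIDTH SEAT 3∕3 on node N15, director-ym №197 ∕ HUMAN RULING D-0149; plan `W-SEAT-START-LIST.md` §n15 item 3 «LG-vector + background layers at
GENERAL small-field U» — forty-third piece).  `bears_on: R4∕N15 · K3⁸ SpineGivenEndpointR13SepCoPHV (stmt-QuantumFields-27366; K3⁷ 20544 aside — KEY MAP v2)`.  Filed `--kind proof --supports
stmt-QuantumFields-27366 --as helper` — COUNT-NEUTRAL.  Theorems only; 0 `sorry`.  Imports BY NAME dag-n15-c's FILE 63∕71 `…TwoSpacingGluingCutRows{,Defect}` (`hasMaj_commOp_lapOp_comp_of_cut`, `hasMaj_idef_commOp_lapOp_comp_of_cut` — the (2.134) piece from CUT rows,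
USED, not restated; FILE 46 `lapOp`, `commOp_lapDir`, `hasMaj_mulOp_comp_loc`, `hasMaj_idef_mulOp_comp_loc`) and FILE 47 `…TwoSpacingGluingDirichlet` (`hasMaj_localize_sandwich`,
`hasMaj_localize_idef_sandwich`); nothing in the tree is modified.  GENERIC carrier `Y`
(at use: `Y := X × ι`, `e μ := liftEquiv (τ μ) ι`, blocks `liftBlk blk ι`, `χ, χ̃` the lifted indicator ∕ bump) — so the statements serve the scalar knit (dag-n15-c FILE 86's `D₃ = lapOp n bshift 0`)
and the vector-carrier dressed cube alike.

WHY.  File 40 (`hasMaj_comp_smoothCutDressed_loc₂`) reduces FILE 58's entry 3 `D₃∘X` of the dressed smooth-cut cube to the FLAT row `D₃∘(M_χ̃N_□) ≤ te^{−δd}` with the output cut-off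
`M_χ∘D₃∘(M_χ̃N_□) = D₃∘(M_χ̃N_□)`.  For the knit's `D₃ = Σ∇*∇ (+ W)` this file supplies both: §1 the EXACT identity `D₃∘(M_χ̃N) = [D₃, M_χ̃]∘N + M_χ̃ + M_χ̃E − M_χ̃M_χN_LN` (from `Δ_a = D₃ + N_L`,
`M_χΔ_aN = M_χ + E`, `M_χ̃M_χ = M_χ̃` — dag-n15-c FILE 86's entry-3 identity with the bump in the middle instead of the partition on the left); §2 the LETTER: the commutator IS dag-n15-c's FILE 63
`hasMaj_commOp_lapOp_comp_of_cut` at `h := χ̃` (ONLY the CUT rows `M_χN`, `M_χ∇^±N` enter: `|J|(c̃₂β + 2c̃β₁) + θ`), the local part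
`1 + ε_E + β_L` (`M_χ̃` two-sided by FILE 47, `E ≤ 1_S1_S·ε_E`, the cut row `M_χ(N_LN) ≤ 1_S1_S·β_L`) — ★★★ `hasMaj_lapOp_comp_smoothCut_loc₂` and its flat form ★★ `hasMaj_lapOp_comp_smoothCut_flat`
(file 40's `hTG`); §3 the OUTPUT CUT-OFF ★★ `mulOp_comp_lapOp_comp_smoothCut` (file 40's `hTχ`) from the reversed insertions and `M_χ[W, M_χ̃] = [W, M_χ̃]`.  §4 the TWO-GRID η-DEFECT of the row
(file 40's `hDTG`): FILE 71 `hasMaj_idef_commOp_lapOp_comp_of_cut` at `h := χ̃` + ★ `hasMaj_idef_smoothCut_localPart` ⟹ ★★★ `hasMaj_idef_lapOp_comp_smoothCut_loc₂`.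

HONEST FRAMING ∕ LIMITS.  Lattice algebra + block-majorant bookkeeping over DISPLAYED rows; nothing of [B5]∕[B6]∕[B9] asserted ((2.91)–(2.92) p.239, (2.133)–(2.134) p.247, (3.42) p.397 entry 3 =
SHAPES ∕ MECHANISM).  NE2⁺ NOT PRINTED, NOT proved; N15 NOT discharged; counts of record UNMOVED (typed 28∕28 · discharged 5∕27); one finite 𝕋⁴ at fixed ε — NOT infinite volume, NOT OS on
ℝ⁴, NOT a mass gap, NOT Clay; R4 closes the conditional finite-𝕋⁴ rung `BalabanLadder.UV` only.
-/

set_option autoImplicit false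

noncomputable section
open scoped BigOperators
open Finset

namespace Summit.QuantumFields.YangMills.BalabanUVNodes.N15.CurvedSpecies

open Literature.MathematicalPhysics.QuantumFieldTheory.Balaban1983to89
open Literature.MathematicalPhysics.QuantumFieldTheory.Balaban1983to89.B11SectG (BlockNorm HasMaj)
open Literature.MathematicalPhysics.QuantumFieldTheory.Balaban1983to89.T4EtaRateDefect (idef idef_add idef_sub)
open Literature.MathematicalPhysics.QuantumFieldTheory.Balaban1983to89.T4EtaRateCoeffDefect (pull hasMaj_mulOp hasMaj_idef_mulOp diagK_le_decay)
open Literature.MathematicalPhysics.QuantumFieldTheory.Balaban1983to89.B6Prop26Gluing (mulOp mulOp_apply ind ind_nonneg ind_le_one)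
open Summit.QuantumFields.YangMills.BalabanUVNodes.N15.BackgroundLayer (fgrad fgradAdj bgrad)
open Summit.QuantumFields.YangMills.BalabanUVNodes.N15.Gluing (commOp lapOp lapDir commOp_lapDir commOp_add_left commOp_fsum_left hasMaj_mulOp_comp_loc hasMaj_idef_mulOp_comp_loc
  hasMaj_commOp_lapOp_comp_of_cut hasMaj_idef_commOp_lapOp_comp_of_cut hasMaj_localize_sandwich hasMaj_localize_idef_sandwich)

variable {Y : Type} [Fintype Y] {J : Type} [Fintype J] {g : B6.Geometry} (blk : Y → g.Site) (e : J → Y ≃ Y) (n : ℝ)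
  {N NL E W Δa : (Y → ℝ) →ₗ[ℝ] (Y → ℝ)} {χ χt : Y → ℝ} {S : Set g.Site} {β β₁ βL εE ct ct₂ θ δ : ℝ}

/-! ## §1 The exact entry-3 identity at the smooth cut -/

omit [Fintype Y] [Fintype J] in
/-- `T∘(M_aN) = [T, M_a]∘N + M_a∘(T∘N)`. [folklore] -/
theorem comp_mulOp_comp_eq_commOp_add (T N₀ : (Y → ℝ) →ₗ[ℝ] (Y → ℝ)) (a : Y → ℝ) : T ∘ₗ (mulOp a ∘ₗ N₀) = commOp T a ∘ₗ N₀ + mulOp a ∘ₗ (T ∘ₗ N₀) := by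
  rw [commOp, LinearMap.sub_comp, LinearMap.comp_assoc, LinearMap.comp_assoc, sub_add_cancel]

omit [Fintype Y] in
/-- ★ **THE LOCAL PART**: `Δ_a = D₃ + N_L`, the per-cube locality with defect `M_χΔ_aN = M_χ + E` and the insertion `M_χ̃M_χ = M_χ̃` give `M_χ̃∘D₃∘N = M_χ̃ + M_χ̃E − M_χ̃M_χN_LN`.
[cite: Balaban1984PropagatorsII, (2.37)–(2.38) p.229, (2.91) p.239 (mechanism)] -/
theorem mulOp_comp_lapOp_comp_of_loc (hΔ : Δa = lapOp n e W + NL) (hloc : mulOp χ ∘ₗ (Δa ∘ₗ N) = mulOp χ + E) (hsub : mulOp χt ∘ₗ mulOp χ = mulOp χt) :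
    mulOp χt ∘ₗ (lapOp n e W ∘ₗ N) = mulOp χt + mulOp χt ∘ₗ E - mulOp χt ∘ₗ (mulOp χ ∘ₗ (NL ∘ₗ N)) := by
  have h1 : lapOp n e W = Δa - NL := by rw [hΔ, add_sub_cancel_right]
  calc mulOp χt ∘ₗ (lapOp n e W ∘ₗ N) = mulOp χt ∘ₗ (Δa ∘ₗ N) - mulOp χt ∘ₗ (NL ∘ₗ N) := by rw [h1, LinearMap.sub_comp, LinearMap.comp_sub]
    _ = (mulOp χt ∘ₗ mulOp χ) ∘ₗ (Δa ∘ₗ N) - (mulOp χt ∘ₗ mulOp χ) ∘ₗ (NL ∘ₗ N) := by rw [hsub]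
    _ = mulOp χt ∘ₗ (mulOp χ ∘ₗ (Δa ∘ₗ N)) - mulOp χt ∘ₗ (mulOp χ ∘ₗ (NL ∘ₗ N)) := by rw [LinearMap.comp_assoc, LinearMap.comp_assoc]
    _ = mulOp χt + mulOp χt ∘ₗ E - mulOp χt ∘ₗ (mulOp χ ∘ₗ (NL ∘ₗ N)) := by rw [hloc, LinearMap.comp_add, hsub]

omit [Fintype Y] in
/-- ★★ **THE ENTRY-3 IDENTITY AT THE SMOOTH CUT**: `D₃∘(M_χ̃N) = [D₃, M_χ̃]∘N + (M_χ̃ + M_χ̃E − M_χ̃M_χN_LN)`. [cite: Balaban1984PropagatorsII, (2.91)–(2.92) p.239 (mechanism); Balaban1985BackgroundPropagators, (3.42) p.397 (entry 3: shape)] -/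
theorem lapOp_comp_smoothCut_eq (hΔ : Δa = lapOp n e W + NL) (hloc : mulOp χ ∘ₗ (Δa ∘ₗ N) = mulOp χ + E) (hsub : mulOp χt ∘ₗ mulOp χ = mulOp χt) :
    lapOp n e W ∘ₗ (mulOp χt ∘ₗ N) = commOp (lapOp n e W) χt ∘ₗ N + (mulOp χt + mulOp χt ∘ₗ E - mulOp χt ∘ₗ (mulOp χ ∘ₗ (NL ∘ₗ N))) := by
  rw [comp_mulOp_comp_eq_commOp_add, mulOp_comp_lapOp_comp_of_loc e n hΔ hloc hsub]

/-! ## §2 The letter: the commutator through the CUT rows, the local part two-sided -/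

omit [Fintype J] in
/-- ★ **THE BUMP's MULTIPLIER, TWO-SIDED**: `|χ̃| ≤ 1`, `M_χM_χ̃M_χ = M_χ̃`, `supp χ` over `S`, `d(y, y) = 0` ⟹ `M_χ̃ ≤ 1_S(y)1_S(y′)·1·e^{−δd}` (diagonal kernel; any real `δ`). [folklore] -/
theorem hasMaj_mulOp_bump_loc₂ (hd0 : ∀ y : g.Site, g.dist y y = 0) (hSχ : ∀ y, χ y ≠ 0 → blk y ∈ S) (hχt : ∀ y, |χt y| ≤ 1)
    (hsand : mulOp χ ∘ₗ mulOp χt ∘ₗ mulOp χ = mulOp χt) :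
    HasMaj (BlockNorm.ofBlocks g blk) (BlockNorm.ofBlocks g blk) (mulOp χt) (fun y y' => ind S y * ind S y' * (1 * Real.exp (-(δ * g.dist y y')))) := by
  have hR : HasMaj (BlockNorm.ofBlocks g blk) (BlockNorm.ofBlocks g blk) (mulOp χt) (fun y y' => 1 * Real.exp (-(δ * g.dist y y'))) := by
    refine (hasMaj_mulOp (g := g) blk (a := χt) (m := fun _ => (1 : ℝ)) (fun _ => zero_le_one) hχt).mono fun y y' => ?_
    have h := diagK_le_decay (g := g) (o := fun _ => (1 : ℝ)) (w := fun _ => (1 : ℝ)) (ε := 1) δ (fun _ => zero_le_one) (fun _ => by norm_num) hd0 y y'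
    simpa using h
  exact hasMaj_localize_sandwich (g := g) blk blk (fun y y' => mul_nonneg zero_le_one (Real.exp_nonneg _)) hsand hSχ hSχ hR

omit [Fintype J] in
/-- ★ **THE LOCAL PART, TWO-SIDED**: `M_χ̃ + M_χ̃E − M_χ̃M_χN_LN ≤ 1_S1_S·(1 + ε_E + β_L)e^{−δd}` from the bump's multiplier, the locality defect's row `E ≤ 1_S1_S·ε_Ee^{−δd}` and the cut row
`M_χ(N_LN) ≤ 1_S1_S·β_Le^{−δd}`. [cite: Balaban1984PropagatorsII, (2.133) p.247 (shape)] -/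
theorem hasMaj_smoothCut_localPart (hd0 : ∀ y : g.Site, g.dist y y = 0) (hSχ : ∀ y, χ y ≠ 0 → blk y ∈ S) (hχt : ∀ y, |χt y| ≤ 1)
    (hsand : mulOp χ ∘ₗ mulOp χt ∘ₗ mulOp χ = mulOp χt)
    (hE : HasMaj (BlockNorm.ofBlocks g blk) (BlockNorm.ofBlocks g blk) E (fun y y' => ind S y * ind S y' * (εE * Real.exp (-(δ * g.dist y y'))))) (hcutL : HasMaj (BlockNorm.ofBlocks g blk) (BlockNorm.ofBlocks g blk) (mulOp χ ∘ₗ (NL ∘ₗ N)) (fun y y' => ind S y * ind S y' * (βL * Real.exp (-(δ * g.dist y y'))))) :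
    HasMaj (BlockNorm.ofBlocks g blk) (BlockNorm.ofBlocks g blk) (mulOp χt + mulOp χt ∘ₗ E - mulOp χt ∘ₗ (mulOp χ ∘ₗ (NL ∘ₗ N))) (fun y y' => ind S y * ind S y' * ((1 + εE + βL) * Real.exp (-(δ * g.dist y y')))) := by
  have h0 := hasMaj_mulOp_bump_loc₂ blk (δ := δ) hd0 hSχ hχt hsand
  have h1 := hasMaj_mulOp_comp_loc blk zero_le_one hχt hE
  have h2 := hasMaj_mulOp_comp_loc blk zero_le_one hχt hcutL
  refine ((h0.add h1).sub h2).mono fun y y' => le_of_eq ?_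
  ring

/-- ★★★ **ENTRY 3 AT THE SMOOTH CUT, TWO-SIDED**: §1's identity + §2's two letters ⟹ `D₃∘(M_χ̃N) ≤ 1_S(y)1_S(y′)·((|J|(c̃₂β + 2c̃β₁) + θ) + (1 + ε_E + β_L))·e^{−δd}` — the flat row file 40
(`hasMaj_comp_smoothCutDressed_loc₂` at `T := D₃`) displays, for `D₃ = Σ∇*∇ + W` with `Δ_a = D₃ + N_L` and the cube's locality-with-defect `M_χΔ_aN = M_χ + E` (dag-n15-a: `E = 0`).
[cite: Balaban1984PropagatorsII, (2.91)–(2.92) p.239, (2.133)–(2.134) p.247 (shapes + mechanism); Balaban1985BackgroundPropagators, (3.42) p.397 (entry 3)] -/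
theorem hasMaj_lapOp_comp_smoothCut_loc₂ (hd0 : ∀ y : g.Site, g.dist y y = 0) (hct : 0 ≤ ct) (hct₂ : 0 ≤ ct₂)
    (hΔ : Δa = lapOp n e W + NL) (hloc : mulOp χ ∘ₗ (Δa ∘ₗ N) = mulOp χ + E) (hSχ : ∀ y, χ y ≠ 0 → blk y ∈ S) (hχt : ∀ y, |χt y| ≤ 1)
    (hsub : mulOp χt ∘ₗ mulOp χ = mulOp χt) (hχ : mulOp χ ∘ₗ mulOp χt = mulOp χt)
    (hd1 : ∀ μ y, |fgrad n (e μ) χt y| ≤ ct) (hd1b : ∀ μ y, |bgrad n (e μ) χt y| ≤ ct) (hd2 : ∀ μ y, |fgradAdj n (e μ) (fgrad n (e μ) χt) y| ≤ ct₂)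
    (hdd : ∀ μ, mulOp (fgrad n (e μ) χt) ∘ₗ mulOp χ = mulOp (fgrad n (e μ) χt)) (hddb : ∀ μ, mulOp (bgrad n (e μ) χt) ∘ₗ mulOp χ = mulOp (bgrad n (e μ) χt))
    (hdd2 : ∀ μ, mulOp (fgradAdj n (e μ) (fgrad n (e μ) χt)) ∘ₗ mulOp χ = mulOp (fgradAdj n (e μ) (fgrad n (e μ) χt)))
    (hcut : HasMaj (BlockNorm.ofBlocks g blk) (BlockNorm.ofBlocks g blk) (mulOp χ ∘ₗ N) (fun y y' => ind S y * ind S y' * (β * Real.exp (-(δ * g.dist y y')))))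
    (hcutF : ∀ μ, HasMaj (BlockNorm.ofBlocks g blk) (BlockNorm.ofBlocks g blk) (mulOp χ ∘ₗ (fgrad n (e μ) ∘ₗ N)) (fun y y' => ind S y * ind S y' * (β₁ * Real.exp (-(δ * g.dist y y')))))
    (hcutB : ∀ μ, HasMaj (BlockNorm.ofBlocks g blk) (BlockNorm.ofBlocks g blk) (mulOp χ ∘ₗ (bgrad n (e μ) ∘ₗ N)) (fun y y' => ind S y * ind S y' * (β₁ * Real.exp (-(δ * g.dist y y')))))
    (hcutL : HasMaj (BlockNorm.ofBlocks g blk) (BlockNorm.ofBlocks g blk) (mulOp χ ∘ₗ (NL ∘ₗ N)) (fun y y' => ind S y * ind S y' * (βL * Real.exp (-(δ * g.dist y y')))))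
    (hE : HasMaj (BlockNorm.ofBlocks g blk) (BlockNorm.ofBlocks g blk) E (fun y y' => ind S y * ind S y' * (εE * Real.exp (-(δ * g.dist y y')))))
    (hW : HasMaj (BlockNorm.ofBlocks g blk) (BlockNorm.ofBlocks g blk) (commOp W χt ∘ₗ N) (fun y y' => ind S y * ind S y' * (θ * Real.exp (-(δ * g.dist y y'))))) :
    HasMaj (BlockNorm.ofBlocks g blk) (BlockNorm.ofBlocks g blk) (lapOp n e W ∘ₗ (mulOp χt ∘ₗ N)) (fun y y' => ind S y * ind S y' * (((Fintype.card J * (ct₂ * β + 2 * (ct * β₁)) + θ) + (1 + εE + βL)) * Real.exp (-(δ * g.dist y y')))) := by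
  have hsand : mulOp χ ∘ₗ mulOp χt ∘ₗ mulOp χ = mulOp χt := by rw [hsub, hχ]
  rw [lapOp_comp_smoothCut_eq e n hΔ hloc hsub]
  refine ((hasMaj_commOp_lapOp_comp_of_cut blk hct hct₂ hd1 hd1b hd2 hdd2 hdd hddb hcut hcutF hcutB hW).add
    (hasMaj_smoothCut_localPart blk hd0 hSχ hχt hsand hE hcutL)).mono fun y y' => le_of_eq ?_
  ring

/-- ★★ **… AND FLAT** (file 40's `hTG` shape `te^{−δd}`): the two-sided row with the indicators dropped (`0 ≤ 1_S ≤ 1`), under `0 ≤ β, β₁, β_L, ε_E, θ`. [cite: Balaban1984PropagatorsII, (2.133) p.247 (shape)] -/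
theorem hasMaj_lapOp_comp_smoothCut_flat (hd0 : ∀ y : g.Site, g.dist y y = 0) (hct : 0 ≤ ct) (hct₂ : 0 ≤ ct₂) (hβ : 0 ≤ β) (hβ₁ : 0 ≤ β₁) (hβL : 0 ≤ βL) (hεE : 0 ≤ εE)
    (hθ : 0 ≤ θ) (hΔ : Δa = lapOp n e W + NL) (hloc : mulOp χ ∘ₗ (Δa ∘ₗ N) = mulOp χ + E) (hSχ : ∀ y, χ y ≠ 0 → blk y ∈ S) (hχt : ∀ y, |χt y| ≤ 1)
    (hsub : mulOp χt ∘ₗ mulOp χ = mulOp χt) (hχ : mulOp χ ∘ₗ mulOp χt = mulOp χt)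
    (hd1 : ∀ μ y, |fgrad n (e μ) χt y| ≤ ct) (hd1b : ∀ μ y, |bgrad n (e μ) χt y| ≤ ct) (hd2 : ∀ μ y, |fgradAdj n (e μ) (fgrad n (e μ) χt) y| ≤ ct₂)
    (hdd : ∀ μ, mulOp (fgrad n (e μ) χt) ∘ₗ mulOp χ = mulOp (fgrad n (e μ) χt)) (hddb : ∀ μ, mulOp (bgrad n (e μ) χt) ∘ₗ mulOp χ = mulOp (bgrad n (e μ) χt))
    (hdd2 : ∀ μ, mulOp (fgradAdj n (e μ) (fgrad n (e μ) χt)) ∘ₗ mulOp χ = mulOp (fgradAdj n (e μ) (fgrad n (e μ) χt)))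
    (hcut : HasMaj (BlockNorm.ofBlocks g blk) (BlockNorm.ofBlocks g blk) (mulOp χ ∘ₗ N) (fun y y' => ind S y * ind S y' * (β * Real.exp (-(δ * g.dist y y')))))
    (hcutF : ∀ μ, HasMaj (BlockNorm.ofBlocks g blk) (BlockNorm.ofBlocks g blk) (mulOp χ ∘ₗ (fgrad n (e μ) ∘ₗ N)) (fun y y' => ind S y * ind S y' * (β₁ * Real.exp (-(δ * g.dist y y')))))
    (hcutB : ∀ μ, HasMaj (BlockNorm.ofBlocks g blk) (BlockNorm.ofBlocks g blk) (mulOp χ ∘ₗ (bgrad n (e μ) ∘ₗ N)) (fun y y' => ind S y * ind S y' * (β₁ * Real.exp (-(δ * g.dist y y')))))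
    (hcutL : HasMaj (BlockNorm.ofBlocks g blk) (BlockNorm.ofBlocks g blk) (mulOp χ ∘ₗ (NL ∘ₗ N)) (fun y y' => ind S y * ind S y' * (βL * Real.exp (-(δ * g.dist y y')))))
    (hE : HasMaj (BlockNorm.ofBlocks g blk) (BlockNorm.ofBlocks g blk) E (fun y y' => ind S y * ind S y' * (εE * Real.exp (-(δ * g.dist y y')))))
    (hW : HasMaj (BlockNorm.ofBlocks g blk) (BlockNorm.ofBlocks g blk) (commOp W χt ∘ₗ N) (fun y y' => ind S y * ind S y' * (θ * Real.exp (-(δ * g.dist y y'))))) :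
    HasMaj (BlockNorm.ofBlocks g blk) (BlockNorm.ofBlocks g blk) (lapOp n e W ∘ₗ (mulOp χt ∘ₗ N))
      (fun y y' => ((Fintype.card J * (ct₂ * β + 2 * (ct * β₁)) + θ) + (1 + εE + βL)) * Real.exp (-(δ * g.dist y y'))) := by
  refine (hasMaj_lapOp_comp_smoothCut_loc₂ blk e n hd0 hct hct₂ hΔ hloc hSχ hχt hsub hχ hd1 hd1b hd2 hdd hddb hdd2 hcut hcutF hcutB hcutL hE hW).mono fun y y' => ?_
  have hc : 0 ≤ ((Fintype.card J * (ct₂ * β + 2 * (ct * β₁)) + θ) + (1 + εE + βL)) * Real.exp (-(δ * g.dist y y')) := by positivity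
  have h1 : ind S y * ind S y' ≤ 1 := mul_le_one₀ (ind_le_one S y) (ind_nonneg S y') (ind_le_one S y')
  calc ind S y * ind S y' * (((Fintype.card J * (ct₂ * β + 2 * (ct * β₁)) + θ) + (1 + εE + βL)) * Real.exp (-(δ * g.dist y y')))
      ≤ 1 * (((Fintype.card J * (ct₂ * β + 2 * (ct * β₁)) + θ) + (1 + εE + βL)) * Real.exp (-(δ * g.dist y y'))) := mul_le_mul_of_nonneg_right h1 hc
    _ = _ := one_mul _

/-! ## §3 The output cut-off `M_χ∘D₃∘(M_χ̃N) = D₃∘(M_χ̃N)` -/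

omit [Fintype Y] in
/-- `T∘Σ_μX_μ = Σ_μ T∘X_μ`. [folklore] -/
theorem comp_fsum_eq (T : (Y → ℝ) →ₗ[ℝ] (Y → ℝ)) (Xμ : J → (Y → ℝ) →ₗ[ℝ] (Y → ℝ)) : T ∘ₗ (∑ μ, Xμ μ) = ∑ μ, T ∘ₗ Xμ μ := by
  refine LinearMap.ext fun f => ?_
  simp only [LinearMap.comp_apply, LinearMap.coe_sum, Finset.sum_apply, map_sum]

omit [Fintype Y] in
/-- ★ **`M_χ[D₃, M_χ̃] = [D₃, M_χ̃]`** from the reversed insertions `M_χM_{∇^±χ̃} = M_{∇^±χ̃}`, `M_χM_{∇*∇χ̃} = M_{∇*∇χ̃}` and `M_χ[W, M_χ̃] = [W, M_χ̃]` (for a multiplication `W`: `[W, M_χ̃] = 0`).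
[cite: Balaban1984PropagatorsII, p.239 («(1.126)–(1.128)»: mechanism)] -/
theorem mulOp_comp_commOp_lapOp (hdd' : ∀ μ, mulOp χ ∘ₗ mulOp (fgrad n (e μ) χt) = mulOp (fgrad n (e μ) χt))
    (hddb' : ∀ μ, mulOp χ ∘ₗ mulOp (bgrad n (e μ) χt) = mulOp (bgrad n (e μ) χt))
    (hdd2' : ∀ μ, mulOp χ ∘ₗ mulOp (fgradAdj n (e μ) (fgrad n (e μ) χt)) = mulOp (fgradAdj n (e μ) (fgrad n (e μ) χt))) (hWχ : mulOp χ ∘ₗ commOp W χt = commOp W χt) :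
    mulOp χ ∘ₗ commOp (lapOp n e W) χt = commOp (lapOp n e W) χt := by
  rw [lapOp, commOp_add_left, commOp_fsum_left, LinearMap.comp_add, hWχ, comp_fsum_eq]
  congr 1
  refine Finset.sum_congr rfl fun μ _ => ?_
  rw [commOp_lapDir, LinearMap.comp_sub, LinearMap.comp_sub, ← LinearMap.comp_assoc, ← LinearMap.comp_assoc, hdd2' μ, hdd' μ, hddb' μ]

omit [Fintype Y] in
/-- ★★ **THE OUTPUT CUT-OFF OF ENTRY 3 AT THE SMOOTH CUT** (file 40's `hTχ` at `T := D₃`): with §1's data, `M_χM_χ̃ = M_χ̃` and ★ above, `M_χ∘(D₃∘(M_χ̃N)) = D₃∘(M_χ̃N)`.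
[cite: Balaban1984PropagatorsII, (2.91) p.239 (mechanism)] -/
theorem mulOp_comp_lapOp_comp_smoothCut (hΔ : Δa = lapOp n e W + NL) (hloc : mulOp χ ∘ₗ (Δa ∘ₗ N) = mulOp χ + E) (hsub : mulOp χt ∘ₗ mulOp χ = mulOp χt)
    (hχ : mulOp χ ∘ₗ mulOp χt = mulOp χt) (hdd' : ∀ μ, mulOp χ ∘ₗ mulOp (fgrad n (e μ) χt) = mulOp (fgrad n (e μ) χt))
    (hddb' : ∀ μ, mulOp χ ∘ₗ mulOp (bgrad n (e μ) χt) = mulOp (bgrad n (e μ) χt))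
    (hdd2' : ∀ μ, mulOp χ ∘ₗ mulOp (fgradAdj n (e μ) (fgrad n (e μ) χt)) = mulOp (fgradAdj n (e μ) (fgrad n (e μ) χt))) (hWχ : mulOp χ ∘ₗ commOp W χt = commOp W χt) :
    mulOp χ ∘ₗ (lapOp n e W ∘ₗ (mulOp χt ∘ₗ N)) = lapOp n e W ∘ₗ (mulOp χt ∘ₗ N) := by
  have hkey := mulOp_comp_commOp_lapOp e n (W := W) hdd' hddb' hdd2' hWχ
  rw [lapOp_comp_smoothCut_eq e n hΔ hloc hsub]
  simp only [LinearMap.comp_add, LinearMap.comp_sub, ← LinearMap.comp_assoc, hχ, hkey]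


/-! ## §4 The two-grid η-defect of the entry-3 row at the smooth cut -/

section Defect

variable {Y' : Type} [Fintype Y'] (π : Y' → Y) (e' : J → Y' ≃ Y') (n' : ℝ) {N' NL' E' W' Δa' : (Y' → ℝ) →ₗ[ℝ] (Y' → ℝ)} {χ' χt' : Y' → ℝ}
  {m₀ m₁ mL mE oχ oχ₁ oχ₂ rW : ℝ}

omit [Fintype J] in
/-- ★ **THE η-DEFECT OF THE LOCAL PART**: the bumps' fit `|χ̃′ − χ̃∘π| ≤ o_χ` (diagonal defect, two-sided by FILE 47), `|χ̃′| ≤ 1`, the rows `E ≤ 1_S1_S·ε_E`, `M_χ(N_LN) ≤ 1_S1_S·β_L` and their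
defects `m_E, m_L` ⟹ `𝔇(M_{χ̃′} + M_{χ̃′}E′ − M_{χ̃′}M_{χ′}N_L′N′, M_χ̃ + M_χ̃E − M_χ̃M_χN_LN) ≤ 1_S1_S·(o_χ + (m_E + o_χε_E) + (m_L + o_χβ_L))·e^{−δd}`.
[cite: Balaban1985BackgroundPropagators, Thm 3.14 pp.426–427 (difference template)] -/
theorem hasMaj_idef_smoothCut_localPart (hd0 : ∀ y : g.Site, g.dist y y = 0) (hoχ : 0 ≤ oχ) (hSχ : ∀ y, χ y ≠ 0 → blk y ∈ S) (hSχ' : ∀ y', χ' y' ≠ 0 → blk (π y') ∈ S)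
    (hχt' : ∀ y', |χt' y'| ≤ 1) (hfitχ : ∀ y', |χt' y' - χt (π y')| ≤ oχ)
    (hsand : mulOp χ ∘ₗ mulOp χt ∘ₗ mulOp χ = mulOp χt) (hsand' : mulOp χ' ∘ₗ mulOp χt' ∘ₗ mulOp χ' = mulOp χt')
    (hE : HasMaj (BlockNorm.ofBlocks g blk) (BlockNorm.ofBlocks g blk) E (fun y y' => ind S y * ind S y' * (εE * Real.exp (-(δ * g.dist y y'))))) (hcutL : HasMaj (BlockNorm.ofBlocks g blk) (BlockNorm.ofBlocks g blk) (mulOp χ ∘ₗ (NL ∘ₗ N)) (fun y y' => ind S y * ind S y' * (βL * Real.exp (-(δ * g.dist y y')))))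
    (hDE : HasMaj (BlockNorm.ofBlocks g blk) (BlockNorm.ofBlocks g (blk ∘ π)) (idef (pull π) (pull π) E' E) (fun y y' => ind S y * ind S y' * (mE * Real.exp (-(δ * g.dist y y')))))
    (hDcutL : HasMaj (BlockNorm.ofBlocks g blk) (BlockNorm.ofBlocks g (blk ∘ π)) (idef (pull π) (pull π) (mulOp χ' ∘ₗ (NL' ∘ₗ N')) (mulOp χ ∘ₗ (NL ∘ₗ N))) (fun y y' => ind S y * ind S y' * (mL * Real.exp (-(δ * g.dist y y'))))) :
    HasMaj (BlockNorm.ofBlocks g blk) (BlockNorm.ofBlocks g (blk ∘ π)) (idef (pull π) (pull π) (mulOp χt' + mulOp χt' ∘ₗ E' - mulOp χt' ∘ₗ (mulOp χ' ∘ₗ (NL' ∘ₗ N'))) (mulOp χt + mulOp χt ∘ₗ E - mulOp χt ∘ₗ (mulOp χ ∘ₗ (NL ∘ₗ N))))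
      (fun y y' => ind S y * ind S y' * ((oχ + (1 * mE + oχ * εE) + (1 * mL + oχ * βL)) * Real.exp (-(δ * g.dist y y')))) := by
  have h0 : HasMaj (BlockNorm.ofBlocks g blk) (BlockNorm.ofBlocks g (blk ∘ π)) (idef (pull π) (pull π) (mulOp χt') (mulOp χt)) (fun y y' => ind S y * ind S y' * (oχ * Real.exp (-(δ * g.dist y y')))) := by
    have hR : HasMaj (BlockNorm.ofBlocks g blk) (BlockNorm.ofBlocks g (blk ∘ π)) (idef (pull π) (pull π) (mulOp χt') (mulOp χt)) (fun y y' => oχ * Real.exp (-(δ * g.dist y y'))) := by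
      refine (hasMaj_idef_mulOp (g := g) blk π (a' := χt') (a := χt) (o := fun _ => oχ) (fun _ => hoχ) hfitχ).mono fun y y' => ?_
      have h := diagK_le_decay (g := g) (o := fun _ => oχ) (w := fun _ => (1 : ℝ)) (ε := oχ) δ (fun _ => hoχ) (fun _ => by norm_num) hd0 y y'
      simpa using h
    exact hasMaj_localize_idef_sandwich (g := g) blk π (fun y y' => mul_nonneg hoχ (Real.exp_nonneg _)) hsand hsand' hSχ hSχ' hR
  have h1 := hasMaj_idef_mulOp_comp_loc blk π zero_le_one hoχ hχt' hfitχ hE hDE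
  have h2 := hasMaj_idef_mulOp_comp_loc blk π zero_le_one hoχ hχt' hfitχ hcutL hDcutL
  rw [idef_sub, idef_add]
  refine ((h0.add h1).sub h2).mono fun y y' => le_of_eq ?_
  ring

/-- ★★★ **THE TWO-GRID η-DEFECT OF ENTRY 3 AT THE SMOOTH CUT** (file 40's `hDTG` at `T := D₃`): §1's identity at both grids + the two defect letters above ⟹
`𝔇(D₃′∘(M_{χ̃′}N′), D₃∘(M_χ̃N)) ≤ 1_S1_S·((|J|(c̃₂m₀ + o_χ₂β + 2(c̃m₁ + o_χ₁β₁)) + r_W) + (o_χ + (m_E + o_χε_E) + (m_L + o_χβ_L)))·e^{−δd}` (two-sided; the flat `m_Te^{−δd}` form follows as in ★★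
`hasMaj_lapOp_comp_smoothCut_flat`). [cite: Balaban1985BackgroundPropagators, Thm 3.14 pp.426–427 (template), (3.42) p.397 (entry 3); Balaban1984PropagatorsII, (2.133)–(2.134) p.247] -/
theorem hasMaj_idef_lapOp_comp_smoothCut_loc₂ (hd0 : ∀ y : g.Site, g.dist y y = 0) (hct : 0 ≤ ct) (hct₂ : 0 ≤ ct₂) (hoχ : 0 ≤ oχ) (hoχ₁ : 0 ≤ oχ₁) (hoχ₂ : 0 ≤ oχ₂)
    (hΔ : Δa = lapOp n e W + NL) (hloc : mulOp χ ∘ₗ (Δa ∘ₗ N) = mulOp χ + E) (hΔ' : Δa' = lapOp n' e' W' + NL') (hloc' : mulOp χ' ∘ₗ (Δa' ∘ₗ N') = mulOp χ' + E')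
    (hSχ : ∀ y, χ y ≠ 0 → blk y ∈ S) (hSχ' : ∀ y', χ' y' ≠ 0 → blk (π y') ∈ S) (hχt' : ∀ y', |χt' y'| ≤ 1) (hfitχ : ∀ y', |χt' y' - χt (π y')| ≤ oχ)
    (hsub : mulOp χt ∘ₗ mulOp χ = mulOp χt) (hχ : mulOp χ ∘ₗ mulOp χt = mulOp χt) (hsub' : mulOp χt' ∘ₗ mulOp χ' = mulOp χt') (hχ' : mulOp χ' ∘ₗ mulOp χt' = mulOp χt')
    (hd1' : ∀ μ y', |fgrad n' (e' μ) χt' y'| ≤ ct) (hd1b' : ∀ μ y', |bgrad n' (e' μ) χt' y'| ≤ ct) (hd2' : ∀ μ y', |fgradAdj n' (e' μ) (fgrad n' (e' μ) χt') y'| ≤ ct₂)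
    (hf1 : ∀ μ y', |fgrad n' (e' μ) χt' y' - fgrad n (e μ) χt (π y')| ≤ oχ₁) (hf1b : ∀ μ y', |bgrad n' (e' μ) χt' y' - bgrad n (e μ) χt (π y')| ≤ oχ₁)
    (hf2 : ∀ μ y', |fgradAdj n' (e' μ) (fgrad n' (e' μ) χt') y' - fgradAdj n (e μ) (fgrad n (e μ) χt) (π y')| ≤ oχ₂)
    (hdd : ∀ μ, mulOp (fgrad n (e μ) χt) ∘ₗ mulOp χ = mulOp (fgrad n (e μ) χt)) (hddb : ∀ μ, mulOp (bgrad n (e μ) χt) ∘ₗ mulOp χ = mulOp (bgrad n (e μ) χt))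
    (hdd2 : ∀ μ, mulOp (fgradAdj n (e μ) (fgrad n (e μ) χt)) ∘ₗ mulOp χ = mulOp (fgradAdj n (e μ) (fgrad n (e μ) χt)))
    (hdd' : ∀ μ, mulOp (fgrad n' (e' μ) χt') ∘ₗ mulOp χ' = mulOp (fgrad n' (e' μ) χt')) (hddb' : ∀ μ, mulOp (bgrad n' (e' μ) χt') ∘ₗ mulOp χ' = mulOp (bgrad n' (e' μ) χt'))
    (hdd2' : ∀ μ, mulOp (fgradAdj n' (e' μ) (fgrad n' (e' μ) χt')) ∘ₗ mulOp χ' = mulOp (fgradAdj n' (e' μ) (fgrad n' (e' μ) χt')))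
    (hcut : HasMaj (BlockNorm.ofBlocks g blk) (BlockNorm.ofBlocks g blk) (mulOp χ ∘ₗ N) (fun y y' => ind S y * ind S y' * (β * Real.exp (-(δ * g.dist y y')))))
    (hcutF : ∀ μ, HasMaj (BlockNorm.ofBlocks g blk) (BlockNorm.ofBlocks g blk) (mulOp χ ∘ₗ (fgrad n (e μ) ∘ₗ N)) (fun y y' => ind S y * ind S y' * (β₁ * Real.exp (-(δ * g.dist y y')))))
    (hcutB : ∀ μ, HasMaj (BlockNorm.ofBlocks g blk) (BlockNorm.ofBlocks g blk) (mulOp χ ∘ₗ (bgrad n (e μ) ∘ₗ N)) (fun y y' => ind S y * ind S y' * (β₁ * Real.exp (-(δ * g.dist y y')))))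
    (hcutL : HasMaj (BlockNorm.ofBlocks g blk) (BlockNorm.ofBlocks g blk) (mulOp χ ∘ₗ (NL ∘ₗ N)) (fun y y' => ind S y * ind S y' * (βL * Real.exp (-(δ * g.dist y y')))))
    (hE : HasMaj (BlockNorm.ofBlocks g blk) (BlockNorm.ofBlocks g blk) E (fun y y' => ind S y * ind S y' * (εE * Real.exp (-(δ * g.dist y y')))))
    (hDcut : HasMaj (BlockNorm.ofBlocks g blk) (BlockNorm.ofBlocks g (blk ∘ π)) (idef (pull π) (pull π) (mulOp χ' ∘ₗ N') (mulOp χ ∘ₗ N)) (fun y y' => ind S y * ind S y' * (m₀ * Real.exp (-(δ * g.dist y y')))))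
    (hDcutF : ∀ μ, HasMaj (BlockNorm.ofBlocks g blk) (BlockNorm.ofBlocks g (blk ∘ π)) (idef (pull π) (pull π) (mulOp χ' ∘ₗ (fgrad n' (e' μ) ∘ₗ N')) (mulOp χ ∘ₗ (fgrad n (e μ) ∘ₗ N))) (fun y y' => ind S y * ind S y' * (m₁ * Real.exp (-(δ * g.dist y y')))))
    (hDcutB : ∀ μ, HasMaj (BlockNorm.ofBlocks g blk) (BlockNorm.ofBlocks g (blk ∘ π)) (idef (pull π) (pull π) (mulOp χ' ∘ₗ (bgrad n' (e' μ) ∘ₗ N')) (mulOp χ ∘ₗ (bgrad n (e μ) ∘ₗ N))) (fun y y' => ind S y * ind S y' * (m₁ * Real.exp (-(δ * g.dist y y')))))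
    (hDcutL : HasMaj (BlockNorm.ofBlocks g blk) (BlockNorm.ofBlocks g (blk ∘ π)) (idef (pull π) (pull π) (mulOp χ' ∘ₗ (NL' ∘ₗ N')) (mulOp χ ∘ₗ (NL ∘ₗ N))) (fun y y' => ind S y * ind S y' * (mL * Real.exp (-(δ * g.dist y y')))))
    (hDE : HasMaj (BlockNorm.ofBlocks g blk) (BlockNorm.ofBlocks g (blk ∘ π)) (idef (pull π) (pull π) E' E) (fun y y' => ind S y * ind S y' * (mE * Real.exp (-(δ * g.dist y y')))))
    (hDW : HasMaj (BlockNorm.ofBlocks g blk) (BlockNorm.ofBlocks g (blk ∘ π)) (idef (pull π) (pull π) (commOp W' χt' ∘ₗ N') (commOp W χt ∘ₗ N)) (fun y y' => ind S y * ind S y' * (rW * Real.exp (-(δ * g.dist y y'))))) :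
    HasMaj (BlockNorm.ofBlocks g blk) (BlockNorm.ofBlocks g (blk ∘ π)) (idef (pull π) (pull π) (lapOp n' e' W' ∘ₗ (mulOp χt' ∘ₗ N')) (lapOp n e W ∘ₗ (mulOp χt ∘ₗ N)))
      (fun y y' => ind S y * ind S y' * (((Fintype.card J * (ct₂ * m₀ + oχ₂ * β + 2 * (ct * m₁ + oχ₁ * β₁)) + rW) + (oχ + (1 * mE + oχ * εE) + (1 * mL + oχ * βL))) * Real.exp (-(δ * g.dist y y')))) := by
  have hsand : mulOp χ ∘ₗ mulOp χt ∘ₗ mulOp χ = mulOp χt := by rw [hsub, hχ]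
  have hsand' : mulOp χ' ∘ₗ mulOp χt' ∘ₗ mulOp χ' = mulOp χt' := by rw [hsub', hχ']
  rw [lapOp_comp_smoothCut_eq e n hΔ hloc hsub, lapOp_comp_smoothCut_eq e' n' hΔ' hloc' hsub', idef_add]
  refine ((hasMaj_idef_commOp_lapOp_comp_of_cut blk π hct hct₂ hoχ₁ hoχ₂ hd1' hd1b' hd2' hf1 hf1b hf2 hdd2 hdd hddb hdd2' hdd' hddb' hcut hcutF hcutB hDcut hDcutF
    hDcutB hDW).add (hasMaj_idef_smoothCut_localPart blk π hd0 hoχ hSχ hSχ' hχt' hfitχ hsand hsand' hE hcutL hDE hDcutL)).mono fun y y' => le_of_eq ?_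
  ring

end Defect

end Summit.QuantumFields.YangMills.BalabanUVNodes.N15.CurvedSpecies

end
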